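import Literature.NumberTheory.Sieve.MatomakiRadziwillLemma4Lipschitz
import Literature.NumberTheory.LFunctions.GranvilleSoundararajanTheorem3Proofs
import Literature.NumberTheory.LFunctions.GranvilleSoundararajanLemma71
import Literature.NumberTheory.LFunctions.MertensFormula
import HarnessLib

/-!
# Granville–Soundararajan 2003, Corollary 3 from Theorem 4 for central maximisers

Topic `Literature/NumberTheory/LFunctions`.  Everything in this file is PROVED.  A. Granville,
K. Soundararajan, *Decay of mean values of multiplicative functions*, Canad. J. Math. 55 (2003),
Corollary 3 (arXiv math/9911246 p. 2; deduction in §7, p. 10), in the form recorded as the named fact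
`GranvilleSoundararajan2003_corollary3` (`x ≥ x₀`, `1 ≤ w ≤ √x`):
`| |S(x)|/x - (w/x)|S(x/w)| | ≤ C((log 2w/log x)^{1-2/π} log(log x/log 2w) + log log x/(log x)^{2-√3})`
for every multiplicative `f` with `|f| ≤ 1`, `S(y) = ∑_{n ≤ y} f(n)`.

* `GranvilleSoundararajan2003_corollary3_of_central4 : (Theorem 4 for central maximisers) →
    GranvilleSoundararajan2003_corollary3`.

The hypothesis, DISPLAYED in the statement (no named fact is introduced), is Theorem 4 of the paper for
`x ≥ x₀`, maximisers `y₀` of `|F(1+iy)|` on `|y| ≤ 2 log x` with `|y₀| ≤ √(log x)`, and `1 ≤ w ≤ √x`.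
The printed Theorem 4 (every maximiser, `w ≤ x/10`) and its rendering `…theorem4_sqrtRange` are false for
maximisers at the edge of the window (see the docstrings in `GranvilleSoundararajan2003.lean`); §6 of the
paper proves the statement for central maximisers `|y₀| ≤ log x`, which implies the form used here.
The other inputs are discharged in the tree: Theorem 1 (`…theorem1_holds`), Lemma 2.3 in the range
`|β| ≤ 4 log x` (`lemma23_range4`), Theorem 3 (`…theorem3_holds`), Lemma 7.1 (`…lemma71_holds`), the
upper bound (4.5) `|F(1+iy)| ≤ e⁷ (log x) e^{-M(y)}` and (7.4)
(`Literature/NumberTheory/Sieve/MatomakiRadziwillLemma4Lipschitz.lean`), Mertens' theorem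
(`MertensFormula.lean`).

## The argument (a variant of §7 that uses (4.5) only as an upper bound)

The printed deduction converts the maximiser `y₀` of `|F|` into a near-minimiser of the distance
`M(y) = ∑_{p ≤ x}(1 - Re f(p)p^{-iy})/p` through (4.5) in both directions; the LOWER bound for `|F|`
fails for merely multiplicative `f` (the Euler factor at `p = 2` may vanish on `Re s = 1`), and Theorem 4
is only available for central maximisers.  Write `ℓ = log x`, `Λ = log ℓ`, `τ = Λ ℓ^{-(2-√3)}`
(the second term of the corollary), let `y₀` maximise `|F_x(1+iy)|` on `|y| ≤ 2ℓ` and `y₁` maximise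
`|F_{x/w}(1+iy)|` on `|y| ≤ 2 log(x/w)`; throughout `|F_{x/w}(1+iy)| ≤ e⁴|F_x(1+iy)|`
(`Cor3.norm_truncEulerProduct_div_le`: the Euler factors at `x/w < p ≤ x` are `≥ e^{-2/(p-1)}` and
`∑_{x/w<p≤x} 1/(p-1) ≤ 2` by Mertens), so `L_{x/w} ≤ 2e⁴ |F_x(1+iy₁)|/ℓ`.
* `|y₀| ≥ √ℓ`: Theorem 3 gives `|S(x)|/x ≪ 1/√ℓ + (Λ^{1+2b}/ℓ^b) ≪ τ` (`b = 1 - 2/π ≥ 9/25`; one `Λ` is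
  absorbed by `Λ ≤ (100/9)ℓ^{9/100}`, `9/25 - 9/100 ≥ 2 - √3`).  If `|y₁| ≥ √ℓ/2`, Theorem 3 at `x/w`
  gives the same for `|S(x/w)|/(x/w)`.  Otherwise `β = y₀ - y₁` has `√ℓ/2 ≤ |β| ≤ 4ℓ`, and Lemma 2.3 at
  `(y₁, β)` with `|F_x(1+iy₁)| ≤ |F_x(1+iy₀)|` gives `|F_x(1+iy₁)| ≤ D ℓ^{16/25} Λ`, so
  `L_{x/w} ≤ 2e⁴DΛ ℓ^{-9/25} ≤ 1` and Theorem 1 at `x/w` gives `|S(x/w)|/(x/w) ≪ Λ²ℓ^{-9/25} ≪ τ`.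
* `|y₀| < √ℓ`, `M(y₀) ≥ (2-√3)Λ`: (4.5) gives `|F_x(1+iy₀)| ≤ e⁷ ℓ^{1-(2-√3)}`, hence
  `L_x ≤ e⁷ℓ^{-(2-√3)}`, `L_{x/w} ≤ 2e^{11}ℓ^{-(2-√3)}`, and Theorem 1 at both scales gives `≪ τ`
  (`L(log(e^γ/L) + 12/7) ≤ L⋆(4 + log(1/L⋆))` for `L ≤ L⋆ ≤ 1`, `Cor3.thm1_main_le_of_le`).
* `|y₀| < √ℓ`, `M(y₀) < (2-√3)Λ`: Cauchy–Schwarz (7.4) gives `∑_{p≤x}|1 - f(p)p^{-iy₀}|/p ≤ (√3-1)(Λ+2)`,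
  so Lemma 7.1 for the twist `f(n)n^{-iy₀}` at `x` and at `x/w` costs `≤ 2e^{3/2}|C₇|τ` per unit, and
  Theorem 4 (the hypothesis, `|y₀| ≤ √ℓ`) compares the twisted means; taking absolute values gives the
  corollary with the `w`-term of Theorem 4.
In the first two cases both means are `≪ τ`, which is stronger.  Constants: `C = |C₄| + K`,
`K = 60|C₃| + 120e⁴D + 10|C₁| + 5e⁷ + 10e^{11} + 30|C₄| + 6e^{3/2}|C₇|`, `D = √max(C₂₃,1)`,
`x₀ = max(exp(max(e^{64}, (23e⁴D)⁴)), x₄)`.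

## References
* A. Granville, K. Soundararajan, *Decay of mean values of multiplicative functions*, Canad. J. Math.
  55 (2003), 1191–1230 (arXiv math/9911246): Corollary 3 (p. 2), Theorem 1, Lemma 2.3, Theorems 3–4,
  (4.5), §7 ((7.4), Lemma 7.1, deduction of Corollary 3, p. 10). [GranvilleSoundararajan2003]
-/

noncomputable section

open Finset Real Complex
open Literature.NumberTheory.Sieve.MatomakiRadziwillL4A

namespace Literature.NumberTheory.LFunctions.GranvilleSoundararajan

namespace Cor3

/-! ### Euler factors in the tail `x/w < p ≤ x`: `|F_{x/w}(1+iy)| ≤ e⁶ |F_x(1+iy)|` -/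

/-- Lower bound for one Euler factor on `Re s = 1`, `p ≥ 3`: `‖E_p(s)‖ ≥ exp(-2/(p-1))`
(`E_p(s) = 1 + O(∑_{k≥1} p^{-k}) = 1 + O(1/(p-1))` and `1 - u ≥ e^{-2u}` for `0 ≤ u ≤ 1/2`). [folklore] -/
theorem exp_neg_le_norm_eulerFactor {g : ℕ → ℂ} (hg : ∀ n, ‖g n‖ ≤ 1) (hg1 : g 1 = 1) {p : ℕ}
    (hp : 3 ≤ p) {s : ℂ} (hs : s.re = 1) :
    Real.exp (-(2 / ((p : ℝ) - 1))) ≤ ‖eulerFactor g p s‖ := by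
  have hp2 : 2 ≤ p := by omega
  have hp3 : (3 : ℝ) ≤ p := by exact_mod_cast hp
  have hp0 : (0 : ℝ) < p := by linarith
  have hsre : 0 < s.re := by rw [hs]; exact one_pos
  rw [eulerFactor_eq_one_add hg hg1 hp2 hsre]
  set T : ℂ := ∑' k : ℕ, g (p ^ (k + 1)) * (p : ℂ) ^ (-(s * (k + 1 : ℕ))) with hT
  -- `‖T‖ ≤ ∑_{k ≥ 1} p^{-k} = (1/p)/(1 - 1/p) = 1/(p-1)`
  set r : ℝ := (p : ℝ)⁻¹ with hr
  have hr0 : 0 ≤ r := by positivity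
  have hr1 : r < 1 := inv_lt_one_of_one_lt₀ (by linarith)
  have hterm : ∀ k : ℕ, ‖g (p ^ (k + 1)) * (p : ℂ) ^ (-(s * (k + 1 : ℕ)))‖ ≤ r * r ^ k := by
    intro k
    have h := norm_term_le hg hp2 s (k + 1)
    rw [hs, Real.rpow_neg_one] at h
    calc _ ≤ (p : ℝ)⁻¹ ^ (k + 1) := h
      _ = r * r ^ k := by rw [hr]; ring
  have hgeo : HasSum (fun k : ℕ => r * r ^ k) (r * (1 - r)⁻¹) :=
    (hasSum_geometric_of_lt_one hr0 hr1).mul_left r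
  have hsumT : Summable fun k : ℕ => g (p ^ (k + 1)) * (p : ℂ) ^ (-(s * (k + 1 : ℕ))) :=
    Summable.of_norm_bounded hgeo.summable hterm
  have hTn : ‖T‖ ≤ 1 / ((p : ℝ) - 1) := by
    calc ‖T‖ ≤ ∑' k : ℕ, ‖g (p ^ (k + 1)) * (p : ℂ) ^ (-(s * (k + 1 : ℕ)))‖ := norm_tsum_le_tsum_norm hsumT.norm
      _ ≤ ∑' k : ℕ, r * r ^ k := hsumT.norm.tsum_le_tsum hterm hgeo.summable
      _ = r * (1 - r)⁻¹ := hgeo.tsum_eq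
      _ = 1 / ((p : ℝ) - 1) := by
          rw [hr]; field_simp
  set u : ℝ := 1 / ((p : ℝ) - 1) with hu
  have hu0 : 0 ≤ u := by rw [hu]; exact div_nonneg zero_le_one (by linarith)
  have hu2 : u ≤ 1 / 2 := by rw [hu]; exact (one_div_le_one_div_of_le (by norm_num) (by linarith))
  -- `‖1 + T‖ ≥ 1 - ‖T‖ ≥ 1 - u ≥ exp(-2u)`
  have h1 : 1 - u ≤ ‖1 + T‖ := by
    have := norm_sub_norm_le (1 : ℂ) (-T)
    rw [norm_one, norm_neg, sub_neg_eq_add] at this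
    linarith
  have h2 : Real.exp (-(2 * u)) ≤ 1 - u := by
    have h3 : 1 + 2 * u ≤ Real.exp (2 * u) := by have := Real.add_one_le_exp (2 * u); linarith
    have h4 : (Real.exp (2 * u))⁻¹ ≤ (1 + 2 * u)⁻¹ := inv_anti₀ (by linarith) h3
    have h5 : (1 + 2 * u)⁻¹ ≤ 1 - u := by
      rw [inv_eq_one_div, div_le_iff₀ (by linarith : (0:ℝ) < 1 + 2 * u)]
      nlinarith
    rw [Real.exp_neg]
    exact h4.trans h5
  have e : -(2 / ((p : ℝ) - 1)) = -(2 * u) := by rw [hu]; ring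
  rw [e]
  exact h2.trans h1


/-- `F_x(s) = F_z(s) · ∏_{z < p ≤ x} E_p(s)` for `z ≤ x`. [folklore] -/
theorem truncEulerProduct_eq_mul_prod_sdiff (g : ℕ → ℂ) {z x : ℝ} (hzx : z ≤ x) (s : ℂ) :
    truncEulerProduct g x s = truncEulerProduct g z s *
      ∏ p ∈ Nat.primesBelow (⌊x⌋₊ + 1) \ Nat.primesBelow (⌊z⌋₊ + 1), eulerFactor g p s := by
  unfold truncEulerProduct
  rw [← Finset.prod_sdiff (primesBelow_mono hzx), mul_comm]

/-- The tail prime sum for `1 ≤ w ≤ √x`, `x ≥ e^{64}`: `∑_{x/w < p ≤ x} 1/(p-1) ≤ 2` (Mertens' second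
theorem with the rate `8/log`, `log log x - log log(x/w) ≤ log 2`). [folklore] -/
theorem sum_tail_inv_pred_le {x w : ℝ} (hx : Real.exp 64 ≤ x) (hw1 : 1 ≤ w) (hw2 : w ≤ Real.sqrt x) :
    ∑ p ∈ Nat.primesBelow (⌊x⌋₊ + 1) \ Nat.primesBelow (⌊x / w⌋₊ + 1), 1 / ((p : ℝ) - 1) ≤ 2 := by
  have hx64 : (64 : ℝ) ≤ Real.log x := by
    rw [← Real.log_exp 64]; exact Real.log_le_log (Real.exp_pos _) hx
  have hx1 : 1 < x := lt_of_lt_of_le (by have := Real.add_one_le_exp (64:ℝ); linarith) hx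
  have hx0 : 0 < x := by linarith
  set z : ℝ := x / w with hz
  have hw0 : 0 < w := by linarith
  have hzx : z ≤ x := div_le_self hx0.le hw1
  have hsqrt : Real.sqrt x * Real.sqrt x = x := Real.mul_self_sqrt hx0.le
  have hsqrt0 : 0 < Real.sqrt x := Real.sqrt_pos.2 hx0
  have hzsqrt : Real.sqrt x ≤ z := by
    rw [hz, le_div_iff₀ hw0]
    calc Real.sqrt x * w ≤ Real.sqrt x * Real.sqrt x := mul_le_mul_of_nonneg_left hw2 hsqrt0.le
      _ = x := hsqrt
  have hlogz : Real.log x / 2 ≤ Real.log z := by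
    have h1 : Real.log (Real.sqrt x) ≤ Real.log z := Real.log_le_log hsqrt0 hzsqrt
    rw [Real.log_sqrt hx0.le] at h1
    exact h1
  have hz0 : 0 < z := by rw [hz]; positivity
  have hz3 : 3 ≤ z := by
    have h32 : (32 : ℝ) ≤ Real.log z := by linarith
    have h1 : Real.exp 32 ≤ z := by
      have := Real.exp_le_exp.2 h32
      rwa [Real.exp_log hz0] at this
    have := Real.add_one_le_exp (32:ℝ); linarith
  have hz2 : 2 ≤ z := by linarith
  have hlogz0 : 0 < Real.log z := by linarith
  -- each tail prime is `> z ≥ e^{32}`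
  have htail : ∀ p ∈ Nat.primesBelow (⌊x⌋₊ + 1) \ Nat.primesBelow (⌊z⌋₊ + 1), z < p := by
    intro p hp
    rw [Finset.mem_sdiff] at hp
    have hp1 := hp.1
    have hp2 := hp.2
    rw [Nat.primesBelow, Finset.mem_filter, Finset.mem_range] at hp1 hp2
    push Not at hp2
    have hge : ⌊z⌋₊ + 1 ≤ p := by
      by_contra h
      push Not at h
      exact absurd hp1.2 (hp2 h)
    calc z < ⌊z⌋₊ + 1 := Nat.lt_floor_add_one z
      _ ≤ p := by exact_mod_cast hge
  -- `1/(p-1) ≤ (3/2)(1/p)` for `p ≥ 3`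
  have hstep : ∑ p ∈ Nat.primesBelow (⌊x⌋₊ + 1) \ Nat.primesBelow (⌊z⌋₊ + 1), 1 / ((p : ℝ) - 1)
      ≤ (3 / 2) * ∑ p ∈ Nat.primesBelow (⌊x⌋₊ + 1) \ Nat.primesBelow (⌊z⌋₊ + 1), (p : ℝ)⁻¹ := by
    rw [Finset.mul_sum]
    refine Finset.sum_le_sum fun p hp => ?_
    have hp3 : (3 : ℝ) ≤ p := by linarith [htail p hp]
    have hp0 : (0 : ℝ) < p := by linarith
    rw [div_le_iff₀ (by linarith), mul_assoc, inv_mul_eq_div, ← mul_div_assoc, le_div_iff₀ hp0]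
    linarith
  refine hstep.trans ?_
  -- the difference of two Mertens sums
  have hsub : Nat.primesBelow (⌊z⌋₊ + 1) ⊆ Nat.primesBelow (⌊x⌋₊ + 1) := primesBelow_mono hzx
  have hdiff : ∑ p ∈ Nat.primesBelow (⌊x⌋₊ + 1) \ Nat.primesBelow (⌊z⌋₊ + 1), (p : ℝ)⁻¹
      = Mertens.primeRecipSum x - Mertens.primeRecipSum z := by
    rw [eq_sub_iff_add_eq]
    exact Finset.sum_sdiff hsub
  rw [hdiff]
  have hMx := Mertens.abs_primeRecipSum_sub_le (x := x) (by linarith)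
  have hMz := Mertens.abs_primeRecipSum_sub_le (x := z) hz2
  rw [abs_le] at hMx hMz
  have hll : Real.log (Real.log x) - Real.log (Real.log z) ≤ Real.log 2 := by
    rw [← Real.log_div (by linarith) hlogz0.ne']
    refine Real.log_le_log (div_pos (by linarith) hlogz0) ?_
    rw [div_le_iff₀ hlogz0]; linarith
  have hl2 : Real.log 2 < 0.6931471808 := Real.log_two_lt_d9
  have h8x : 8 / Real.log x ≤ 1 / 8 := by rw [div_le_div_iff₀ (by linarith) (by norm_num)]; linarith
  have h8z : 8 / Real.log z ≤ 1 / 4 := by rw [div_le_div_iff₀ hlogz0 (by norm_num)]; linarith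
  linarith

/-- **Tail comparison**: `‖F_{x/w}(1+iy)‖ ≤ e⁴ ‖F_x(1+iy)‖` for `1`-bounded `g` with `g(1) = 1`,
`x ≥ e^{64}`, `1 ≤ w ≤ √x` (divide out the Euler factors at `x/w < p ≤ x`, each `≥ e^{-2/(p-1)}`). [folklore] -/
theorem norm_truncEulerProduct_div_le {g : ℕ → ℂ} (hg : ∀ n, ‖g n‖ ≤ 1) (hg1 : g 1 = 1) {x w : ℝ}
    (hx : Real.exp 64 ≤ x) (hw1 : 1 ≤ w) (hw2 : w ≤ Real.sqrt x) (y : ℝ) :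
    ‖truncEulerProduct g (x / w) (1 + y * I)‖ ≤ Real.exp 4 * ‖truncEulerProduct g x (1 + y * I)‖ := by
  have hx1 : 1 < x := lt_of_lt_of_le (by have := Real.add_one_le_exp (64:ℝ); linarith) hx
  have hx0 : 0 < x := by linarith
  have hzx : x / w ≤ x := div_le_self hx0.le hw1
  set P := Nat.primesBelow (⌊x⌋₊ + 1) \ Nat.primesBelow (⌊x / w⌋₊ + 1) with hP
  set s : ℂ := 1 + y * I with hs
  have hsre : s.re = 1 := by simp [hs]
  have hprod := truncEulerProduct_eq_mul_prod_sdiff g hzx s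
  rw [← hP] at hprod
  -- lower bound for the tail product
  have htail3 : ∀ p ∈ P, 3 ≤ p := by
    intro p hp
    have hp' := hp
    rw [hP, Finset.mem_sdiff] at hp'
    rw [Nat.primesBelow, Finset.mem_filter, Finset.mem_range, Nat.primesBelow, Finset.mem_filter,
      Finset.mem_range] at hp'
    obtain ⟨⟨_, hpp⟩, h2⟩ := hp'
    push Not at h2
    have hge : ⌊x / w⌋₊ + 1 ≤ p := by
      by_contra h; push Not at h; exact absurd hpp (h2 h)
    -- `x/w ≥ √x ≥ 2`, so `p ≥ 3`
    have hw0 : 0 < w := by linarith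
    have hsqrt0 : 0 < Real.sqrt x := Real.sqrt_pos.2 hx0
    have h4 : (2 : ℝ) ≤ x / w := by
      rw [le_div_iff₀ hw0]
      have h16 : (16 : ℝ) ≤ x := le_trans (by have := Real.add_one_le_exp (64:ℝ); linarith) hx
      have hs4 : 4 ≤ Real.sqrt x := by
        rw [show (4:ℝ) = Real.sqrt 16 by rw [show (16:ℝ) = 4 ^ 2 by norm_num, Real.sqrt_sq (by norm_num)]]
        exact Real.sqrt_le_sqrt h16
      nlinarith [Real.mul_self_sqrt hx0.le]
    have h5 : 2 ≤ ⌊x / w⌋₊ := Nat.le_floor (by exact_mod_cast h4)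
    omega
  have hlow : Real.exp (-4) ≤ ‖∏ p ∈ P, eulerFactor g p s‖ := by
    rw [norm_prod]
    have h1 : ∏ p ∈ P, Real.exp (-(2 / ((p : ℝ) - 1))) ≤ ∏ p ∈ P, ‖eulerFactor g p s‖ :=
      Finset.prod_le_prod (fun p _ => (Real.exp_pos _).le) fun p hp =>
        exp_neg_le_norm_eulerFactor hg hg1 (htail3 p hp) hsre
    refine le_trans ?_ h1
    rw [← Real.exp_sum, Real.exp_le_exp]
    have h2 := sum_tail_inv_pred_le hx hw1 hw2
    rw [← hP] at h2
    have h3 : ∑ p ∈ P, -(2 / ((p : ℝ) - 1)) = -(2 * ∑ p ∈ P, 1 / ((p : ℝ) - 1)) := by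
      rw [Finset.mul_sum, ← Finset.sum_neg_distrib]
      exact Finset.sum_congr rfl fun p _ => by ring
    rw [h3]; linarith
  have hpos : 0 < ‖∏ p ∈ P, eulerFactor g p s‖ := lt_of_lt_of_le (Real.exp_pos _) hlow
  have heq : ‖truncEulerProduct g x s‖ = ‖truncEulerProduct g (x / w) s‖ * ‖∏ p ∈ P, eulerFactor g p s‖ := by
    rw [hprod, norm_mul]
  calc ‖truncEulerProduct g (x / w) s‖
      = ‖truncEulerProduct g x s‖ / ‖∏ p ∈ P, eulerFactor g p s‖ := by
        rw [heq, mul_div_assoc, div_self hpos.ne', mul_one]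
    _ ≤ ‖truncEulerProduct g x s‖ / Real.exp (-4) := div_le_div_of_nonneg_left (norm_nonneg _) (Real.exp_pos _) hlow
    _ = Real.exp 4 * ‖truncEulerProduct g x s‖ := by rw [Real.exp_neg, div_inv_eq_mul, mul_comm]

/-! ### Theorem 1 with an upper bound `L ≤ L⋆ ≤ 1` -/

/-- If `0 ≤ L ≤ L⋆ ≤ 1` then `L(log(e^γ/L) + 12/7) ≤ L⋆(4 + log(1/L⋆))` (from `log t ≤ t - 1` at
`t = L⋆/L` and `γ < 1`). [folklore] -/
theorem thm1_main_le_of_le {L Ls : ℝ} (hL0 : 0 ≤ L) (hLs : L ≤ Ls) (hLs1 : Ls ≤ 1) (hLs0 : 0 < Ls) :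
    L * (Real.log (Real.exp Real.eulerMascheroniConstant / L) + 12 / 7) ≤ Ls * (4 + Real.log (1 / Ls)) := by
  have hγ : Real.eulerMascheroniConstant < 2 / 3 := Real.eulerMascheroniConstant_lt_two_thirds
  have hlog0 : 0 ≤ Real.log (1 / Ls) := Real.log_nonneg (by rw [le_div_iff₀ hLs0]; linarith)
  rcases hL0.eq_or_lt with h0 | hLpos
  · rw [← h0, zero_mul]; exact mul_nonneg hLs0.le (by linarith)
  · have h1 : Real.log (Real.exp Real.eulerMascheroniConstant / L)
        = Real.eulerMascheroniConstant + Real.log (Ls / L) + Real.log (1 / Ls) := by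
      rw [Real.log_div (Real.exp_pos _).ne' hLpos.ne', Real.log_exp, Real.log_div hLs0.ne' hLpos.ne',
        one_div, Real.log_inv]
      ring
    have h2 : Real.log (Ls / L) ≤ Ls / L - 1 := Real.log_le_sub_one_of_pos (div_pos hLs0 hLpos)
    have h3 : L * Real.log (Ls / L) ≤ Ls - L := by
      calc L * Real.log (Ls / L) ≤ L * (Ls / L - 1) := mul_le_mul_of_nonneg_left h2 hL0
        _ = Ls - L := by field_simp
    have h4 : L * Real.log (1 / Ls) ≤ Ls * Real.log (1 / Ls) := mul_le_mul_of_nonneg_right hLs hlog0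
    rw [h1]
    nlinarith


/-- **Theorem 1 with an upper bound for `L`**: if `H1` is Theorem 1 of GS03 with constant `C₁`, `Z ≥ 3`,
`log Z ≥ 1`, and `maxModulus g Z (log Z)/log Z ≤ L⋆ ≤ 1`, then
`‖∑_{n≤Z} g(n)‖/Z ≤ L⋆(4 + log(1/L⋆)) + |C₁|(1/log Z + log log Z/log Z)`. [cite: GranvilleSoundararajan2003, Theorem 1] -/
theorem thm1_apply {C₁ : ℝ}
    (H1 : ∀ f : ArithmeticFunction ℂ, f.IsMultiplicative → (∀ n, ‖f n‖ ≤ 1) →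
      ∀ x T : ℝ, 3 ≤ x → 1 ≤ T →
        ‖∑ n ∈ Icc 1 ⌊x⌋₊, f n‖ / x ≤
          (maxModulus f x T / Real.log x) *
              (Real.log (Real.exp Real.eulerMascheroniConstant / (maxModulus f x T / Real.log x)) + 12 / 7)
            + C₁ * (1 / T + Real.log (Real.log x) / Real.log x))
    {g : ArithmeticFunction ℂ} (hgm : g.IsMultiplicative) (hg1 : ∀ n, ‖g n‖ ≤ 1) {Z : ℝ} (hZ3 : 3 ≤ Z)
    (hℓ1 : 1 ≤ Real.log Z) {Ls : ℝ} (hLs : maxModulus g Z (Real.log Z) / Real.log Z ≤ Ls) (hLs1 : Ls ≤ 1)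
    (hLs0 : 0 < Ls) :
    ‖∑ n ∈ Icc 1 ⌊Z⌋₊, g n‖ / Z ≤
      Ls * (4 + Real.log (1 / Ls)) + |C₁| * (1 / Real.log Z + Real.log (Real.log Z) / Real.log Z) := by
  have key := H1 g hgm hg1 Z (Real.log Z) hZ3 hℓ1
  have hL0 : 0 ≤ maxModulus g Z (Real.log Z) / Real.log Z :=
    div_nonneg (maxModulus_nonneg hg1 Z (by linarith)) (by linarith)
  have h1 := thm1_main_le_of_le hL0 hLs hLs1 hLs0
  have h2 : C₁ * (1 / Real.log Z + Real.log (Real.log Z) / Real.log Z) ≤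
      |C₁| * (1 / Real.log Z + Real.log (Real.log Z) / Real.log Z) := by
    refine mul_le_mul_of_nonneg_right (le_abs_self _) ?_
    have : 0 ≤ Real.log (Real.log Z) := Real.log_nonneg hℓ1
    positivity
  linarith

/-- `L⋆(4 + log(1/L⋆)) ≤ 5 K' (log ℓ) ℓ^{-c}` for `L⋆ = K' ℓ^{-c}`, `K' ≥ 1`, `0 < c ≤ 1`, `log ℓ ≥ 4`. [folklore] -/
theorem Ls_main_le {K' c ℓ : ℝ} (hK' : 1 ≤ K') (hc1 : c ≤ 1) (hℓ : 1 ≤ ℓ)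
    (hΛ4 : 4 ≤ Real.log ℓ) :
    K' * ℓ ^ (-c) * (4 + Real.log (1 / (K' * ℓ ^ (-c)))) ≤ 5 * K' * Real.log ℓ * ℓ ^ (-c) := by
  have hℓ0 : 0 < ℓ := by linarith
  have hpow : 0 < ℓ ^ (-c) := Real.rpow_pos_of_pos hℓ0 _
  have h1 : Real.log (1 / (K' * ℓ ^ (-c))) = c * Real.log ℓ - Real.log K' := by
    rw [one_div, Real.log_inv, Real.log_mul (by linarith) hpow.ne', Real.log_rpow hℓ0]; ring
  have h2 : Real.log (1 / (K' * ℓ ^ (-c))) ≤ Real.log ℓ := by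
    rw [h1]
    have hK : 0 ≤ Real.log K' := Real.log_nonneg hK'
    have hl : 0 ≤ Real.log ℓ := by linarith
    nlinarith
  have h3 : 4 + Real.log (1 / (K' * ℓ ^ (-c))) ≤ 5 * Real.log ℓ := by linarith
  calc K' * ℓ ^ (-c) * (4 + Real.log (1 / (K' * ℓ ^ (-c)))) ≤ K' * ℓ ^ (-c) * (5 * Real.log ℓ) :=
        mul_le_mul_of_nonneg_left h3 (by positivity)
    _ = 5 * K' * Real.log ℓ * ℓ ^ (-c) := by ring

/-! ### Exponents and absorptions -/

/-- `267/1000 ≤ 2 - √3 ≤ 268/1000`. [folklore] -/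
theorem two_sub_sqrt_three_bounds : 267 / 1000 ≤ 2 - Real.sqrt 3 ∧ 2 - Real.sqrt 3 ≤ 268 / 1000 := by
  constructor
  · have : Real.sqrt 3 ≤ 1733 / 1000 := by
      rw [show (1733 / 1000 : ℝ) = Real.sqrt ((1733 / 1000) ^ 2) by rw [Real.sqrt_sq (by norm_num)]]
      exact Real.sqrt_le_sqrt (by norm_num)
    linarith
  · have : (1732 / 1000 : ℝ) ≤ Real.sqrt 3 := by
      rw [show (1732 / 1000 : ℝ) = Real.sqrt ((1732 / 1000) ^ 2) by rw [Real.sqrt_sq (by norm_num)]]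
      exact Real.sqrt_le_sqrt (by norm_num)
    linarith

/-- `9/25 ≤ 1 - 2/π ≤ 1/2` and `4/π ≤ 32/25`. [folklore] -/
theorem pi_exponent_bounds : 9 / 25 ≤ 1 - 2 / Real.pi ∧ 1 - 2 / Real.pi ≤ 1 / 2 ∧ 4 / Real.pi ≤ 32 / 25 := by
  have hπ := Real.pi_gt_d2
  have hπ4 := Real.pi_lt_four
  refine ⟨?_, ?_, ?_⟩
  · have : 2 / Real.pi ≤ 16 / 25 := by rw [div_le_div_iff₀ Real.pi_pos (by norm_num)]; linarith
    linarith
  · have : 1 / 2 ≤ 2 / Real.pi := by rw [div_le_div_iff₀ (by norm_num) Real.pi_pos]; linarith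
    linarith
  · rw [div_le_div_iff₀ Real.pi_pos (by norm_num)]; linarith

/-- Absorbing one logarithm: `(log ℓ)² ℓ^{-9/25} ≤ 12 (log ℓ) ℓ^{-(2-√3)}` for `ℓ ≥ 1`, `log ℓ ≥ 0`
(`log ℓ ≤ (100/9) ℓ^{9/100}` and `9/25 - 9/100 = 27/100 ≥ 2 - √3`). [folklore] -/
theorem sq_log_mul_rpow_le {ℓ : ℝ} (hℓ : 1 ≤ ℓ) :
    Real.log ℓ ^ 2 * ℓ ^ (-(9 / 25 : ℝ)) ≤ 12 * (Real.log ℓ * ℓ ^ (-(2 - Real.sqrt 3))) := by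
  have hℓ0 : 0 < ℓ := by linarith
  have hΛ0 : 0 ≤ Real.log ℓ := Real.log_nonneg hℓ
  have h1 : Real.log ℓ ≤ ℓ ^ (9 / 100 : ℝ) / (9 / 100) := Real.log_le_rpow_div hℓ0.le (by norm_num)
  have ha := two_sub_sqrt_three_bounds
  have h2 : ℓ ^ (9 / 100 : ℝ) / (9 / 100) * ℓ ^ (-(9 / 25 : ℝ)) ≤ 12 * ℓ ^ (-(2 - Real.sqrt 3)) := by
    rw [div_mul_eq_mul_div, div_le_iff₀ (by norm_num : (0:ℝ) < 9 / 100), ← Real.rpow_add hℓ0]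
    have h3 : ℓ ^ ((9 / 100 : ℝ) + -(9 / 25)) ≤ ℓ ^ (-(2 - Real.sqrt 3)) :=
      Real.rpow_le_rpow_of_exponent_le hℓ (by linarith)
    have h4 : 0 ≤ ℓ ^ (-(2 - Real.sqrt 3)) := Real.rpow_nonneg hℓ0.le _
    nlinarith
  calc Real.log ℓ ^ 2 * ℓ ^ (-(9 / 25 : ℝ)) = Real.log ℓ * (Real.log ℓ * ℓ ^ (-(9 / 25 : ℝ))) := by ring
    _ ≤ Real.log ℓ * (ℓ ^ (9 / 100 : ℝ) / (9 / 100) * ℓ ^ (-(9 / 25 : ℝ))) := by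
        refine mul_le_mul_of_nonneg_left (mul_le_mul_of_nonneg_right h1 (Real.rpow_nonneg hℓ0.le _)) hΛ0
    _ ≤ Real.log ℓ * (12 * ℓ ^ (-(2 - Real.sqrt 3))) := mul_le_mul_of_nonneg_left h2 hΛ0
    _ = 12 * (Real.log ℓ * ℓ ^ (-(2 - Real.sqrt 3))) := by ring

/-- The second term of Theorems 3–4 is absorbed: for `1 ≤ ℓ'`, `1 ≤ log ℓ'`, `ℓ' ≤ ℓ`, `ℓ ≤ 2ℓ'`:
`(log log)^{1+2(1-2/π)}/(log)^{1-2/π}` at `ℓ'` is `≤ 24 (log ℓ) ℓ^{-(2-√3)}`. [folklore] -/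
theorem R3_le {ℓ ℓ' : ℝ} (hℓ'1 : 1 ≤ ℓ') (hΛ'1 : 1 ≤ Real.log ℓ') (hℓ'ℓ : ℓ' ≤ ℓ) (hℓℓ' : ℓ ≤ 2 * ℓ') :
    Real.log ℓ' ^ (1 + 2 * (1 - 2 / Real.pi)) / ℓ' ^ (1 - 2 / Real.pi) ≤
      24 * (Real.log ℓ * ℓ ^ (-(2 - Real.sqrt 3))) := by
  obtain ⟨hb1, hb2, -⟩ := pi_exponent_bounds
  have hℓ'0 : 0 < ℓ' := by linarith
  have hℓ1 : 1 ≤ ℓ := by linarith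
  have hℓ0 : 0 < ℓ := by linarith
  have hΛ' : Real.log ℓ' ≤ Real.log ℓ := Real.log_le_log hℓ'0 hℓ'ℓ
  have hΛ1 : 1 ≤ Real.log ℓ := hΛ'1.trans hΛ'
  -- numerator
  have hnum : Real.log ℓ' ^ (1 + 2 * (1 - 2 / Real.pi)) ≤ Real.log ℓ ^ 2 := by
    calc Real.log ℓ' ^ (1 + 2 * (1 - 2 / Real.pi)) ≤ Real.log ℓ' ^ (2 : ℝ) :=
          Real.rpow_le_rpow_of_exponent_le hΛ'1 (by linarith)
      _ ≤ Real.log ℓ ^ (2 : ℝ) := Real.rpow_le_rpow (by linarith) hΛ' (by norm_num)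
      _ = Real.log ℓ ^ 2 := by rw [show (2:ℝ) = (2:ℕ) by norm_num, Real.rpow_natCast]
  -- denominator: `ℓ'^b ≥ ℓ'^{9/25} ≥ (ℓ/2)^{9/25} ≥ ℓ^{9/25}/2`
  have hden : ℓ ^ (9 / 25 : ℝ) / 2 ≤ ℓ' ^ (1 - 2 / Real.pi) := by
    have h1 : ℓ' ^ (9 / 25 : ℝ) ≤ ℓ' ^ (1 - 2 / Real.pi) := Real.rpow_le_rpow_of_exponent_le hℓ'1 hb1
    have h2 : (ℓ / 2) ^ (9 / 25 : ℝ) ≤ ℓ' ^ (9 / 25 : ℝ) := Real.rpow_le_rpow (by linarith) (by linarith) (by norm_num)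
    have h3 : ℓ ^ (9 / 25 : ℝ) / 2 ≤ (ℓ / 2) ^ (9 / 25 : ℝ) := by
      rw [Real.div_rpow hℓ0.le (by norm_num)]
      refine div_le_div_of_nonneg_left (Real.rpow_nonneg hℓ0.le _) (Real.rpow_pos_of_pos two_pos _) ?_
      have : (2:ℝ) ^ (9 / 25 : ℝ) ≤ (2:ℝ) ^ (1:ℝ) := Real.rpow_le_rpow_of_exponent_le (by norm_num) (by norm_num)
      rwa [Real.rpow_one] at this
    linarith
  have hden0 : 0 < ℓ ^ (9 / 25 : ℝ) / 2 := by positivity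
  calc Real.log ℓ' ^ (1 + 2 * (1 - 2 / Real.pi)) / ℓ' ^ (1 - 2 / Real.pi)
      ≤ Real.log ℓ ^ 2 / (ℓ ^ (9 / 25 : ℝ) / 2) := by
        refine div_le_div₀ (by positivity) hnum hden0 hden
    _ = 2 * (Real.log ℓ ^ 2 * ℓ ^ (-(9 / 25 : ℝ))) := by
        rw [Real.rpow_neg hℓ0.le]; field_simp
    _ ≤ 2 * (12 * (Real.log ℓ * ℓ ^ (-(2 - Real.sqrt 3)))) := by
        have := sq_log_mul_rpow_le hℓ1; linarith
    _ = 24 * (Real.log ℓ * ℓ ^ (-(2 - Real.sqrt 3))) := by ring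

end Cor3


open Cor3 in
set_option maxHeartbeats 2000000 in
/-- **Granville–Soundararajan 2003, Corollary 3** (as recorded in `GranvilleSoundararajan2003_corollary3`:
`x ≥ x₀`, `1 ≤ w ≤ √x`) **from Theorem 4 for central maximisers** — the displayed hypothesis `h4` is
Theorem 4 of the paper for `x ≥ x₀`, maximisers `y₀` of `|F(1+iy)|` on `|y| ≤ 2 log x` with
`|y₀| ≤ √(log x)`, and `1 ≤ w ≤ √x` (what §6 proves covers all `|y₀| ≤ log x`).  Theorem 1, Lemma 2.3
(range `|β| ≤ 4 log x`), Theorem 3 and Lemma 7.1 are taken from their discharges in the tree.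

The printed deduction (§7, arXiv p. 10) converts the maximiser `y₀` of `|F|` into a near-minimiser of
the distance `∑_p (1 - Re f(p)p^{-iy})/p` through (4.5) in both directions; the lower bound for `|F|`
fails for merely multiplicative `f` (the Euler factor at `p = 2` may vanish on `Re s = 1`), and Theorem 4
is only available for central maximisers.  The argument below uses (4.5) only as an upper bound and
splits instead on the position of the maximisers (`ℓ = log x`, `Λ = log ℓ`, `τ = Λ ℓ^{-(2-√3)}`,
`y₀`/`y₁` maximisers for `F_x` on `|y| ≤ 2ℓ` / for `F_{x/w}` on `|y| ≤ 2 log(x/w)`; throughout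
`|F_{x/w}(1+iy)| ≤ e⁴ |F_x(1+iy)|`, `Cor3.norm_truncEulerProduct_div_le`):
* `|y₀| ≥ √ℓ`: `|S(x)|/x ≪ τ` by Theorem 3.  If `|y₁| ≥ √ℓ/2`, also `|S(x/w)|/(x/w) ≪ τ` by Theorem 3
  at `x/w`; otherwise `|y₀ - y₁| ≥ √ℓ/2` and Lemma 2.3 at `(y₁, y₀ - y₁)` with `|F_x(1+iy₁)| ≤ |F_x(1+iy₀)|`
  gives `|F_x(1+iy₁)| ≪ ℓ^{16/25} Λ`, so `max |F_{x/w}| = |F_{x/w}(1+iy₁)| ≪ ℓ^{16/25}Λ` and Theorem 1 at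
  `x/w` gives `|S(x/w)|/(x/w) ≪ Λ² ℓ^{-9/25} ≪ τ`.
* `|y₀| < √ℓ`, `M = ∑_{p≤x}(1 - Re f(p)p^{-iy₀})/p ≥ (2-√3)Λ`: (4.5) (upper bound) gives
  `max|F_x| ≤ e⁷ ℓ^{1-(2-√3)}`, hence `max|F_{x/w}| ≤ e^{11} ℓ^{1-(2-√3)}`, and Theorem 1 at both scales
  gives `≪ τ`.
* `|y₀| < √ℓ`, `M < (2-√3)Λ`: by Cauchy–Schwarz `∑_{p≤x}|1 - f(p)p^{-iy₀}|/p ≤ (√3-1)(Λ+2)`, so Lemma 7.1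
  (for the twist `f(n)n^{-iy₀}`, at `x` and at `x/w`) costs `≪ τ`, and Theorem 4 (`h4`, `|y₀| ≤ √ℓ`)
  compares the twisted means; taking absolute values gives the claim with the `w`-term of Theorem 4.
[cite: GranvilleSoundararajan2003, Corollary 3 and §7] -/
theorem GranvilleSoundararajan2003_corollary3_of_central4
    (h4 : ∃ C x₀ : ℝ, ∀ f : ArithmeticFunction ℂ, f.IsMultiplicative → (∀ n, ‖f n‖ ≤ 1) →
      ∀ x : ℝ, x₀ ≤ x → ∀ y₀ : ℝ, |y₀| ≤ Real.sqrt (Real.log x) →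
        (∀ y : ℝ, |y| ≤ 2 * Real.log x →
          ‖truncEulerProduct f x (1 + y * I)‖ ≤ ‖truncEulerProduct f x (1 + y₀ * I)‖) →
        ∀ w : ℝ, 1 ≤ w → w ≤ Real.sqrt x →
          ‖(x : ℂ)⁻¹ * ∑ n ∈ Icc 1 ⌊x⌋₊, f n * (n : ℂ) ^ (-(y₀ * I))
              - ((w / x : ℝ) : ℂ) * ∑ n ∈ Icc 1 ⌊x / w⌋₊, f n * (n : ℂ) ^ (-(y₀ * I))‖ ≤
            C * ((Real.log (2 * w) / Real.log x) ^ (1 - 2 / Real.pi)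
                    * Real.log (Real.log x / Real.log (2 * w))
                  + Real.log (Real.log x) ^ (1 + 2 * (1 - 2 / Real.pi)) / Real.log x ^ (1 - 2 / Real.pi))) :
    GranvilleSoundararajan2003_corollary3 := by
  obtain ⟨C₁, H1⟩ := GranvilleSoundararajan2003_theorem1_holds
  obtain ⟨C₂₃, H23⟩ := lemma23_range4
  obtain ⟨C₃, H3⟩ := GranvilleSoundararajan2003_theorem3_holds
  obtain ⟨C₄, x₄, H4⟩ := h4
  obtain ⟨C₇, H7⟩ := GranvilleSoundararajan2003_lemma71_holds
  obtain ⟨ha1, ha2⟩ := two_sub_sqrt_three_bounds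
  obtain ⟨hb1, hb2, hb3⟩ := pi_exponent_bounds
  -- constants
  set C₂ := max C₂₃ 1 with hC₂
  have hC₂1 : 1 ≤ C₂ := le_max_right _ _
  have hC₂le : C₂₃ ≤ C₂ := le_max_left _ _
  set D := Real.sqrt C₂ with hD
  have hD1 : 1 ≤ D := Real.one_le_sqrt.mpr hC₂1
  have hD0 : 0 < D := by linarith
  have hDsq : D * D = C₂ := Real.mul_self_sqrt (by linarith)
  set ℓ₀ := max (Real.exp 64) ((23 * Real.exp 4 * D) ^ 4) with hℓ₀
  set K := 60 * |C₃| + 120 * Real.exp 4 * D + 10 * |C₁| + 5 * Real.exp 7 + 10 * Real.exp 11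
    + 30 * |C₄| + 6 * Real.exp (3 / 2) * |C₇| with hK
  have hK0 : 0 ≤ K := by rw [hK]; positivity
  have hc3 : 0 ≤ |C₃| := abs_nonneg _
  have hc1 : 0 ≤ |C₁| := abs_nonneg _
  have hc4 : 0 ≤ |C₄| := abs_nonneg _
  have hc7 : 0 ≤ Real.exp (3 / 2) * |C₇| := by positivity
  have he4D : 0 ≤ Real.exp 4 * D := by positivity
  have he7 : 0 ≤ Real.exp 7 := (Real.exp_pos _).le
  have he11 : 0 ≤ Real.exp 11 := (Real.exp_pos _).le
  refine ⟨|C₄| + K, max (Real.exp ℓ₀) x₄, ?_⟩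
  intro f hf hfb x w hx hw1 hw2
  have hf11 : f 1 = 1 := hf.map_one
  /- sizes -/
  have hxℓ₀ : Real.exp ℓ₀ ≤ x := (le_max_left _ _).trans hx
  have hx₄ : x₄ ≤ x := (le_max_right _ _).trans hx
  have hℓ₀64 : Real.exp 64 ≤ ℓ₀ := le_max_left _ _
  have hℓ₀D : (23 * Real.exp 4 * D) ^ 4 ≤ ℓ₀ := le_max_right _ _
  have hxpos : 0 < x := (Real.exp_pos _).trans_le hxℓ₀
  set ℓ := Real.log x with hℓ
  have hℓge : ℓ₀ ≤ ℓ := by rw [hℓ, ← Real.log_exp ℓ₀]; exact Real.log_le_log (Real.exp_pos _) hxℓ₀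
  have hℓe64 : Real.exp 64 ≤ ℓ := hℓ₀64.trans hℓge
  have hℓD : (23 * Real.exp 4 * D) ^ 4 ≤ ℓ := hℓ₀D.trans hℓge
  have he64 : (64 : ℝ) ≤ Real.exp 64 := by have := Real.add_one_le_exp (64:ℝ); linarith
  have hℓ64 : 64 ≤ ℓ := he64.trans hℓe64
  have hℓ1 : 1 ≤ ℓ := by linarith
  have hℓ0 : 0 < ℓ := by linarith
  have hxexp : x = Real.exp ℓ := by rw [hℓ, Real.exp_log hxpos]
  have hx64 : Real.exp 64 ≤ x := by rw [hxexp]; exact Real.exp_le_exp.2 hℓ64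
  have hx3 : 3 ≤ x := le_trans (by have := Real.add_one_le_exp (64:ℝ); linarith) hx64
  set Λ := Real.log ℓ with hΛ
  have hΛ64 : 64 ≤ Λ := by rw [hΛ, ← Real.log_exp 64]; exact Real.log_le_log (Real.exp_pos _) hℓe64
  have hΛ1 : 1 ≤ Λ := by linarith
  have hΛ0 : 0 < Λ := by linarith
  set a := 2 - Real.sqrt 3 with ha
  set τ := Λ * ℓ ^ (-a) with hτ
  have hτ0 : 0 < τ := mul_pos hΛ0 (Real.rpow_pos_of_pos hℓ0 _)
  have hτeq : Real.log (Real.log x) / Real.log x ^ (2 - Real.sqrt 3) = τ := by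
    rw [← hℓ, ← hΛ, hτ, ha, Real.rpow_neg hℓ0.le, div_eq_mul_inv]
  -- powers of `ℓ` against `τ`
  have hpa : ℓ ^ (-a) ≤ τ := by
    rw [hτ]; exact le_mul_of_one_le_left (Real.rpow_nonneg hℓ0.le _) hΛ1
  have hp_half : ℓ ^ (-(1 / 2 : ℝ)) ≤ ℓ ^ (-a) := Real.rpow_le_rpow_of_exponent_le hℓ1 (by linarith)
  have hp_one : ℓ⁻¹ ≤ ℓ ^ (-a) := by
    rw [← Real.rpow_neg_one]; exact Real.rpow_le_rpow_of_exponent_le hℓ1 (by linarith)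
  have hΛℓ : Λ / ℓ ≤ τ := by
    rw [hτ, div_eq_mul_inv]; exact mul_le_mul_of_nonneg_left hp_one hΛ0.le
  have hsqrtℓ : Real.sqrt ℓ * Real.sqrt ℓ = ℓ := Real.mul_self_sqrt hℓ0.le
  have hsqrtℓ8 : 8 ≤ Real.sqrt ℓ := by
    rw [show (8:ℝ) = Real.sqrt 64 by rw [show (64:ℝ) = 8 ^ 2 by norm_num, Real.sqrt_sq (by norm_num)]]
    exact Real.sqrt_le_sqrt hℓ64
  have hsqrt_inv : 1 / Real.sqrt ℓ ≤ τ := by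
    have : 1 / Real.sqrt ℓ = ℓ ^ (-(1 / 2 : ℝ)) := by
      rw [Real.sqrt_eq_rpow, Real.rpow_neg hℓ0.le, one_div]
    rw [this]; exact hp_half.trans hpa
  -- `log ℓ ≤ (100/9) ℓ^{9/100}` and `ℓ^{1/4} ≥ 23 e⁴ D`
  have hΛpow : Λ ≤ 100 / 9 * ℓ ^ (9 / 100 : ℝ) := by
    have := Real.log_le_rpow_div hℓ0.le (by norm_num : (0:ℝ) < 9 / 100)
    rw [← hΛ] at this
    linarith [show ℓ ^ (9 / 100 : ℝ) / (9 / 100) = 100 / 9 * ℓ ^ (9 / 100 : ℝ) by ring]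
  have hℓquarter : 23 * Real.exp 4 * D ≤ ℓ ^ (1 / 4 : ℝ) := by
    have h1 : ((23 * Real.exp 4 * D) ^ 4) ^ (1 / 4 : ℝ) ≤ ℓ ^ (1 / 4 : ℝ) :=
      Real.rpow_le_rpow (by positivity) hℓD (by norm_num)
    rwa [← Real.rpow_natCast, ← Real.rpow_mul (by positivity), show ((4:ℕ):ℝ) * (1 / 4) = 1 by norm_num,
      Real.rpow_one] at h1
  /- the scale `x/w` -/
  have hw0 : 0 < w := by linarith
  have hsqrtx : Real.sqrt x * Real.sqrt x = x := Real.mul_self_sqrt hxpos.le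
  have hsqrtx0 : 0 < Real.sqrt x := Real.sqrt_pos.2 hxpos
  set z := x / w with hz
  have hz0 : 0 < z := by rw [hz]; positivity
  have hzx : z ≤ x := div_le_self hxpos.le hw1
  have hzsqrt : Real.sqrt x ≤ z := by
    rw [hz, le_div_iff₀ hw0]
    calc Real.sqrt x * w ≤ Real.sqrt x * Real.sqrt x := mul_le_mul_of_nonneg_left hw2 hsqrtx0.le
      _ = x := hsqrtx
  set ℓ' := Real.log z with hℓ'
  have hℓ'ℓ : ℓ' ≤ ℓ := Real.log_le_log hz0 hzx
  have hℓℓ' : ℓ ≤ 2 * ℓ' := by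
    have h1 : Real.log (Real.sqrt x) ≤ ℓ' := Real.log_le_log hsqrtx0 hzsqrt
    rw [Real.log_sqrt hxpos.le, ← hℓ] at h1
    linarith
  have hℓ'32 : 32 ≤ ℓ' := by linarith
  have hℓ'1 : 1 ≤ ℓ' := by linarith
  have hℓ'0 : 0 < ℓ' := by linarith
  have hz3 : 3 ≤ z := by
    have h1 : Real.exp 32 ≤ z := by
      have := Real.exp_le_exp.2 hℓ'32
      rwa [hℓ', Real.exp_log hz0] at this
    have := Real.add_one_le_exp (32:ℝ); linarith
  set Λ' := Real.log ℓ' with hΛ'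
  have hΛ'Λ : Λ' ≤ Λ := Real.log_le_log hℓ'0 hℓ'ℓ
  have hΛ'1 : 1 ≤ Λ' := by
    rw [hΛ', ← Real.log_exp 1]
    refine Real.log_le_log (Real.exp_pos 1) (le_trans ?_ hℓ'32)
    have := Real.exp_one_lt_d9; linarith
  have hinvℓ' : 1 / ℓ' ≤ 2 * ℓ⁻¹ := by
    rw [div_le_iff₀ hℓ'0]
    have : 2 * ℓ⁻¹ * ℓ' ≥ 2 * ℓ⁻¹ * (ℓ / 2) := by gcongr; linarith
    have e : 2 * ℓ⁻¹ * (ℓ / 2) = 1 := by field_simp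
    linarith
  have hΛ'ℓ' : Λ' / ℓ' ≤ 2 * (Λ / ℓ) := by
    calc Λ' / ℓ' ≤ Λ / ℓ' := div_le_div_of_nonneg_right hΛ'Λ hℓ'0.le
      _ = Λ * (1 / ℓ') := by ring
      _ ≤ Λ * (2 * ℓ⁻¹) := mul_le_mul_of_nonneg_left hinvℓ' hΛ0.le
      _ = 2 * (Λ / ℓ) := by ring
  -- Theorem 1 remainders at the two scales
  have hrem_x : |C₁| * (1 / Real.log x + Real.log (Real.log x) / Real.log x) ≤ 2 * |C₁| * τ := by
    rw [← hℓ, ← hΛ]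
    have h1 : 1 / ℓ ≤ τ := by rw [one_div]; exact hp_one.trans hpa
    have : 1 / ℓ + Λ / ℓ ≤ 2 * τ := by linarith
    calc |C₁| * (1 / ℓ + Λ / ℓ) ≤ |C₁| * (2 * τ) := mul_le_mul_of_nonneg_left this (abs_nonneg _)
      _ = 2 * |C₁| * τ := by ring
  have hrem_z : |C₁| * (1 / Real.log z + Real.log (Real.log z) / Real.log z) ≤ 4 * |C₁| * τ := by
    rw [← hℓ', ← hΛ']
    have h1 : 1 / ℓ' ≤ 2 * τ := hinvℓ'.trans (by linarith [hp_one.trans hpa])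
    have h2 : Λ' / ℓ' ≤ 2 * τ := hΛ'ℓ'.trans (by linarith)
    calc |C₁| * (1 / ℓ' + Λ' / ℓ') ≤ |C₁| * (4 * τ) := mul_le_mul_of_nonneg_left (by linarith) (abs_nonneg _)
      _ = 4 * |C₁| * τ := by ring
  /- the sums -/
  set SX := ∑ n ∈ Icc 1 ⌊x⌋₊, f n with hSX
  set SZ := ∑ n ∈ Icc 1 ⌊z⌋₊, f n with hSZ
  have hwx : w / x * ‖SZ‖ = ‖SZ‖ / z := by rw [hz]; field_simp
  have hgoal : Real.log (Real.log x) / Real.log x ^ (2 - Real.sqrt 3) = τ := hτeq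
  rw [hgoal]
  -- the `w`-term is nonnegative
  set Wt := (Real.log (2 * w) / Real.log x) ^ (1 - 2 / Real.pi) * Real.log (Real.log x / Real.log (2 * w)) with hWt
  have hlog2w : Real.log 2 ≤ Real.log (2 * w) ∧ Real.log (2 * w) ≤ ℓ := by
    constructor
    · exact Real.log_le_log two_pos (by linarith)
    · rw [hℓ]
      refine Real.log_le_log (by linarith) ?_
      have : (2:ℝ) ≤ Real.sqrt x := by
        calc (2:ℝ) ≤ 8 := by norm_num
          _ ≤ Real.sqrt ℓ := hsqrtℓ8
          _ ≤ Real.sqrt x := Real.sqrt_le_sqrt (by rw [hℓ]; have := Real.log_le_sub_one_of_pos hxpos; linarith)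
      calc 2 * w ≤ Real.sqrt x * Real.sqrt x := mul_le_mul this hw2 (by linarith) hsqrtx0.le
        _ = x := hsqrtx
  have hlog2 : 1 / 2 < Real.log 2 := by have := Real.log_two_gt_d9; linarith
  have hWt0 : 0 ≤ Wt := by
    rw [hWt, ← hℓ]
    refine mul_nonneg (Real.rpow_nonneg (div_nonneg (by linarith [hlog2w.1]) hℓ0.le) _) (Real.log_nonneg ?_)
    rw [le_div_iff₀ (by linarith [hlog2w.1])]; linarith [hlog2w.2]
  /- the maximisers -/
  obtain ⟨y₀, hy₀, hmax⟩ := exists_maximiser (g := f) hfb x (T := ℓ) hℓ0.le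
  obtain ⟨y₁, hy₁, hmax₁⟩ := exists_maximiser (g := f) hfb z (T := ℓ') hℓ'0.le
  have hy₀' : |y₀| ≤ 2 * Real.log x := by rw [← hℓ]; exact hy₀
  have hmax' : ∀ y : ℝ, |y| ≤ 2 * Real.log x →
      ‖truncEulerProduct f x (1 + y * I)‖ ≤ ‖truncEulerProduct f x (1 + y₀ * I)‖ := by
    rw [← hℓ]; exact hmax
  have hy₁' : |y₁| ≤ 2 * Real.log z := by rw [← hℓ']; exact hy₁
  have hmax₁' : ∀ y : ℝ, |y| ≤ 2 * Real.log z →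
      ‖truncEulerProduct f z (1 + y * I)‖ ≤ ‖truncEulerProduct f z (1 + y₁ * I)‖ := by
    rw [← hℓ']; exact hmax₁
  set ΛF := ‖truncEulerProduct f x (1 + y₀ * I)‖ with hΛF
  have hy₁ℓ : |y₁| ≤ 2 * ℓ := hy₁.trans (by linarith)
  have hF1le : ‖truncEulerProduct f x (1 + y₁ * I)‖ ≤ ΛF := hmax y₁ hy₁ℓ
  -- `maxModulus` at the two scales
  obtain ⟨hM0, hMΛ⟩ := maxModulus_le (g := f) x hℓ0.le hmax
  obtain ⟨hM0z, hMΛz⟩ := maxModulus_le (g := f) z hℓ'0.le hmax₁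
  have htailF : ‖truncEulerProduct f z (1 + y₁ * I)‖ ≤ Real.exp 4 * ‖truncEulerProduct f x (1 + y₁ * I)‖ :=
    norm_truncEulerProduct_div_le hfb hf11 hx64 hw1 hw2 y₁
  -- Theorem 1 at `z = x/w` from a bound `‖F_x(1+iy₁)‖ ≤ B`: `L_z ≤ 2e⁴B/ℓ`
  have hLz : ∀ {B : ℝ}, ‖truncEulerProduct f x (1 + y₁ * I)‖ ≤ B →
      maxModulus f z (Real.log z) / Real.log z ≤ 2 * Real.exp 4 * B * ℓ⁻¹ := by
    intro B hB
    rw [← hℓ']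
    have hB0 : 0 ≤ B := (norm_nonneg _).trans hB
    calc maxModulus f z ℓ' / ℓ' ≤ Real.exp 4 * B / ℓ' :=
          div_le_div_of_nonneg_right (hMΛz.trans (htailF.trans (mul_le_mul_of_nonneg_left hB (Real.exp_pos _).le))) hℓ'0.le
      _ = Real.exp 4 * B * (1 / ℓ') := by ring
      _ ≤ Real.exp 4 * B * (2 * ℓ⁻¹) := mul_le_mul_of_nonneg_left hinvℓ' (by positivity)
      _ = 2 * Real.exp 4 * B * ℓ⁻¹ := by ring
  have hLx : maxModulus f x (Real.log x) / Real.log x ≤ ΛF / ℓ := by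
    rw [← hℓ]; exact div_le_div_of_nonneg_right hMΛ hℓ0.le
  -- how the two kinds of conclusions give the claim
  have habs : |‖SX‖ / x - w / x * ‖SZ‖| ≤ ‖SX‖ / x + ‖SZ‖ / z := by
    rw [hwx]
    have h1 : 0 ≤ ‖SX‖ / x := by positivity
    have h2 : 0 ≤ ‖SZ‖ / z := by positivity
    rw [abs_le]; constructor <;> linarith
  have hfinish : ∀ {A B : ℝ}, ‖SX‖ / x ≤ A * τ → ‖SZ‖ / z ≤ B * τ → 0 ≤ A → 0 ≤ B → A + B ≤ K →
      |‖SX‖ / x - w / x * ‖SZ‖| ≤ (|C₄| + K) * (Wt + τ) := by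
    intro A B hA hB hA0 hB0 hAB
    calc |‖SX‖ / x - w / x * ‖SZ‖| ≤ ‖SX‖ / x + ‖SZ‖ / z := habs
      _ ≤ (A + B) * τ := by linarith
      _ ≤ K * τ := mul_le_mul_of_nonneg_right hAB hτ0.le
      _ ≤ (|C₄| + K) * (Wt + τ) := by
          have : K * τ ≤ (|C₄| + K) * τ := mul_le_mul_of_nonneg_right (by linarith [abs_nonneg C₄]) hτ0.le
          have : (|C₄| + K) * τ ≤ (|C₄| + K) * (Wt + τ) := mul_le_mul_of_nonneg_left (by linarith) (by positivity)
          linarith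
  /- the second terms of Theorems 3–4 at the two scales -/
  have hR3x : Real.log (Real.log x) ^ (1 + 2 * (1 - 2 / Real.pi)) / Real.log x ^ (1 - 2 / Real.pi) ≤ 24 * τ := by
    have h := R3_le (ℓ := ℓ) (ℓ' := ℓ) hℓ1 hΛ1 le_rfl (by linarith)
    rw [← hΛ, ← ha, ← hτ] at h
    rw [← hℓ, ← hΛ]
    exact h
  have hR3z : Real.log (Real.log z) ^ (1 + 2 * (1 - 2 / Real.pi)) / Real.log z ^ (1 - 2 / Real.pi) ≤ 24 * τ := by
    have h := R3_le (ℓ := ℓ) (ℓ' := ℓ') hℓ'1 hΛ'1 hℓ'ℓ hℓℓ'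
    rw [← hΛ, ← ha, ← hτ] at h
    rw [← hℓ']
    exact h
  rcases le_or_gt (Real.sqrt ℓ) |y₀| with hi | hii
  · /- Case (i): `|y₀| ≥ √ℓ` — Theorem 3 at `x` -/
    have hSx : ‖SX‖ / x ≤ 25 * |C₃| * τ := by
      have key := H3 f hf hfb x hx3 y₀ hy₀' hmax'
      have h1 : 1 / (1 + |y₀|) ≤ τ := by
        calc 1 / (1 + |y₀|) ≤ 1 / Real.sqrt ℓ := one_div_le_one_div_of_le (by positivity) (by linarith)
          _ ≤ τ := hsqrt_inv
      have hpos : 0 ≤ 1 / (1 + |y₀|) + Real.log (Real.log x) ^ (1 + 2 * (1 - 2 / Real.pi)) / Real.log x ^ (1 - 2 / Real.pi) := by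
        rw [← hℓ]; positivity
      calc ‖SX‖ / x ≤ |C₃| * (1 / (1 + |y₀|) + Real.log (Real.log x) ^ (1 + 2 * (1 - 2 / Real.pi)) / Real.log x ^ (1 - 2 / Real.pi)) :=
            key.trans (mul_le_mul_of_nonneg_right (le_abs_self _) hpos)
        _ ≤ |C₃| * (τ + 24 * τ) := mul_le_mul_of_nonneg_left (add_le_add h1 hR3x) (abs_nonneg _)
        _ = 25 * |C₃| * τ := by ring
    rcases le_or_gt (Real.sqrt ℓ / 2) |y₁| with hi1 | hi2
    · /- (i-1): `|y₁| ≥ √ℓ/2` — Theorem 3 at `x/w` -/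
      have hSz : ‖SZ‖ / z ≤ 26 * |C₃| * τ := by
        have key := H3 f hf hfb z hz3 y₁ hy₁' hmax₁'
        have h1 : 1 / (1 + |y₁|) ≤ 2 * τ := by
          calc 1 / (1 + |y₁|) ≤ 1 / (Real.sqrt ℓ / 2) := one_div_le_one_div_of_le (by positivity) (by linarith)
            _ = 2 * (1 / Real.sqrt ℓ) := by field_simp
            _ ≤ 2 * τ := by linarith [hsqrt_inv]
        have hpos : 0 ≤ 1 / (1 + |y₁|) + Real.log (Real.log z) ^ (1 + 2 * (1 - 2 / Real.pi)) / Real.log z ^ (1 - 2 / Real.pi) := by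
          rw [← hℓ']; positivity
        calc ‖SZ‖ / z ≤ |C₃| * (1 / (1 + |y₁|) + Real.log (Real.log z) ^ (1 + 2 * (1 - 2 / Real.pi)) / Real.log z ^ (1 - 2 / Real.pi)) :=
              key.trans (mul_le_mul_of_nonneg_right (le_abs_self _) hpos)
          _ ≤ |C₃| * (2 * τ + 24 * τ) := mul_le_mul_of_nonneg_left (add_le_add h1 hR3z) (abs_nonneg _)
          _ = 26 * |C₃| * τ := by ring
      exact hfinish hSx hSz (by positivity) (by positivity) (by rw [hK]; linarith)
    · /- (i-2): `|y₁| < √ℓ/2` — Lemma 2.3 at `(y₁, y₀ - y₁)` and Theorem 1 at `x/w` -/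
      have hβlo : 1 / Real.log x ≤ |y₀ - y₁| := by
        rw [← hℓ]
        have h1 : 1 / ℓ ≤ 1 := by rw [div_le_one hℓ0]; exact hℓ1
        have h2 : Real.sqrt ℓ / 2 ≤ |y₀ - y₁| := by
          have := abs_sub_abs_le_abs_sub y₀ y₁; linarith
        linarith
      have hβhi : |y₀ - y₁| ≤ 4 * Real.log x := by
        rw [← hℓ]
        calc |y₀ - y₁| ≤ |y₀| + |y₁| := abs_sub _ _
          _ ≤ 2 * ℓ + 2 * ℓ := add_le_add hy₀ hy₁ℓ
          _ = 4 * ℓ := by ring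
      have key := H23 f hf hfb x hx3 y₁ (y₀ - y₁) hβlo hβhi
      have e1 : ((y₁ : ℝ) : ℂ) + ((y₀ - y₁ : ℝ) : ℂ) = (y₀ : ℂ) := by push_cast; ring
      rw [e1, norm_mul, ← hℓ, ← hΛ] at key
      -- the right-hand side of Lemma 2.3 is `≤ C₂ ℓ^{32/25} Λ²`
      have hΛsq : 1 ≤ Λ ^ 2 := one_le_pow₀ hΛ1
      have hmx1 : 1 ≤ max (1 / |y₀ - y₁|) (Λ ^ 2) := le_max_of_le_right hΛsq
      have hmxΛ : max (1 / |y₀ - y₁|) (Λ ^ 2) ≤ Λ ^ 2 := by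
        refine max_le ?_ le_rfl
        have h1 : 1 / |y₀ - y₁| ≤ 1 / (Real.sqrt ℓ / 2) :=
          one_div_le_one_div_of_le (by positivity) (by have := abs_sub_abs_le_abs_sub y₀ y₁; linarith)
        have h2 : 1 / (Real.sqrt ℓ / 2) ≤ 1 := by rw [div_le_one (by positivity)]; linarith
        exact h1.trans (h2.trans hΛsq)
      have hfac2 : max (1 / |y₀ - y₁|) (Λ ^ 2) ^ (2 * (1 - 2 / Real.pi)) ≤ Λ ^ 2 := by
        have := Real.rpow_le_rpow_of_exponent_le hmx1 (by linarith : 2 * (1 - 2 / Real.pi) ≤ (1 : ℝ))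
        rw [Real.rpow_one] at this
        exact this.trans hmxΛ
      have hfac1 : ℓ ^ (4 / Real.pi) ≤ ℓ ^ (32 / 25 : ℝ) := Real.rpow_le_rpow_of_exponent_le hℓ1 hb3
      have hprod : ‖truncEulerProduct f x (1 + y₁ * I)‖ * ΛF ≤ C₂ * ℓ ^ (32 / 25 : ℝ) * Λ ^ 2 := by
        refine key.trans ?_
        have hnn : 0 ≤ ℓ ^ (4 / Real.pi) * max (1 / |y₀ - y₁|) (Λ ^ 2) ^ (2 * (1 - 2 / Real.pi)) := by positivity
        calc C₂₃ * ℓ ^ (4 / Real.pi) * max (1 / |y₀ - y₁|) (Λ ^ 2) ^ (2 * (1 - 2 / Real.pi))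
            = C₂₃ * (ℓ ^ (4 / Real.pi) * max (1 / |y₀ - y₁|) (Λ ^ 2) ^ (2 * (1 - 2 / Real.pi))) := by ring
          _ ≤ C₂ * (ℓ ^ (32 / 25 : ℝ) * Λ ^ 2) :=
              mul_le_mul hC₂le (mul_le_mul hfac1 hfac2 (by positivity) (by positivity)) hnn (by linarith)
          _ = _ := by ring
      have hFy₁sq : ‖truncEulerProduct f x (1 + y₁ * I)‖ * ‖truncEulerProduct f x (1 + y₁ * I)‖
          ≤ (D * ℓ ^ (16 / 25 : ℝ) * Λ) * (D * ℓ ^ (16 / 25 : ℝ) * Λ) := by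
        have e : (D * ℓ ^ (16 / 25 : ℝ) * Λ) * (D * ℓ ^ (16 / 25 : ℝ) * Λ)
            = (D * D) * (ℓ ^ (16 / 25 : ℝ) * ℓ ^ (16 / 25 : ℝ)) * Λ ^ 2 := by ring
        rw [e, hDsq, ← Real.rpow_add hℓ0]; norm_num
        calc ‖truncEulerProduct f x (1 + y₁ * I)‖ * ‖truncEulerProduct f x (1 + y₁ * I)‖
            ≤ ‖truncEulerProduct f x (1 + y₁ * I)‖ * ΛF := mul_le_mul_of_nonneg_left hF1le (norm_nonneg _)
          _ ≤ C₂ * ℓ ^ (32 / 25 : ℝ) * Λ ^ 2 := hprod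
      have hFy₁le : ‖truncEulerProduct f x (1 + y₁ * I)‖ ≤ D * ℓ ^ (16 / 25 : ℝ) * Λ :=
        (mul_self_le_mul_self_iff (norm_nonneg _) (by positivity)).2 hFy₁sq
      -- `L_{x/w} ≤ L⋆ = (2e⁴DΛ) ℓ^{-9/25} ≤ 1`
      obtain ⟨K', hK'⟩ : ∃ K' : ℝ, K' = 2 * Real.exp 4 * D * Λ := ⟨_, rfl⟩
      have hK'1 : 1 ≤ K' := by
        rw [hK']
        have h1 : (1:ℝ) ≤ Real.exp 4 := by have := Real.add_one_le_exp (4:ℝ); linarith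
        have h2 : (1:ℝ) ≤ Real.exp 4 * D := one_le_mul_of_one_le_of_one_le h1 hD1
        have h3 : (1:ℝ) ≤ Real.exp 4 * D * Λ := one_le_mul_of_one_le_of_one_le h2 hΛ1
        linarith
      have hLs : maxModulus f z (Real.log z) / Real.log z ≤ K' * ℓ ^ (-(9 / 25 : ℝ)) := by
        refine (hLz hFy₁le).trans (le_of_eq ?_)
        rw [hK', show (-(9 / 25 : ℝ)) = 16 / 25 + (-1) by norm_num, Real.rpow_add hℓ0, Real.rpow_neg_one]
        ring
      have hLs1 : K' * ℓ ^ (-(9 / 25 : ℝ)) ≤ 1 := by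
        have h1 : K' * ℓ ^ (-(9 / 25 : ℝ)) ≤ 2 * Real.exp 4 * D * (100 / 9 * ℓ ^ (9 / 100 : ℝ)) * ℓ ^ (-(9 / 25 : ℝ)) := by
          rw [hK']
          refine mul_le_mul_of_nonneg_right ?_ (Real.rpow_nonneg hℓ0.le _)
          exact mul_le_mul_of_nonneg_left hΛpow (by positivity)
        have h2 : 2 * Real.exp 4 * D * (100 / 9 * ℓ ^ (9 / 100 : ℝ)) * ℓ ^ (-(9 / 25 : ℝ))
            = 200 / 9 * Real.exp 4 * D * ℓ ^ (-(27 / 100 : ℝ)) := by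
          rw [show (-(27 / 100 : ℝ)) = 9 / 100 + (-(9 / 25)) by norm_num, Real.rpow_add hℓ0]; ring
        have h3 : ℓ ^ (-(27 / 100 : ℝ)) ≤ ℓ ^ (-(1 / 4 : ℝ)) := Real.rpow_le_rpow_of_exponent_le hℓ1 (by norm_num)
        have h4 : ℓ ^ (-(1 / 4 : ℝ)) * (23 * Real.exp 4 * D) ≤ 1 := by
          rw [Real.rpow_neg hℓ0.le]
          calc (ℓ ^ (1 / 4 : ℝ))⁻¹ * (23 * Real.exp 4 * D) ≤ (ℓ ^ (1 / 4 : ℝ))⁻¹ * ℓ ^ (1 / 4 : ℝ) :=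
                mul_le_mul_of_nonneg_left hℓquarter (by positivity)
            _ = 1 := inv_mul_cancel₀ (by positivity)
        have h5 : 200 / 9 * Real.exp 4 * D * ℓ ^ (-(27 / 100 : ℝ)) ≤ 200 / 9 * Real.exp 4 * D * ℓ ^ (-(1 / 4 : ℝ)) :=
          mul_le_mul_of_nonneg_left h3 (by positivity)
        have h6 : 200 / 9 * Real.exp 4 * D * ℓ ^ (-(1 / 4 : ℝ)) ≤ 1 := by
          have : 200 / 9 * Real.exp 4 * D * ℓ ^ (-(1 / 4 : ℝ)) = (200 / 207) * (ℓ ^ (-(1 / 4 : ℝ)) * (23 * Real.exp 4 * D)) := by ring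
          rw [this]
          have := mul_le_mul_of_nonneg_left h4 (by norm_num : (0:ℝ) ≤ 200 / 207)
          linarith
        linarith
      have hLs0 : 0 < K' * ℓ ^ (-(9 / 25 : ℝ)) := by positivity
      have hT1 := thm1_apply H1 hf hfb hz3 (by rw [← hℓ']; exact hℓ'1) hLs hLs1 hLs0
      have hmainz : K' * ℓ ^ (-(9 / 25 : ℝ)) * (4 + Real.log (1 / (K' * ℓ ^ (-(9 / 25 : ℝ))))) ≤ 120 * Real.exp 4 * D * τ := by
        have h1 := Ls_main_le (c := 9 / 25) hK'1 (by norm_num) hℓ1 (by rw [← hΛ]; linarith)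
        rw [← hΛ] at h1
        refine h1.trans ?_
        have h2 := sq_log_mul_rpow_le hℓ1
        rw [← hΛ, ← ha, ← hτ] at h2
        calc 5 * K' * Λ * ℓ ^ (-(9 / 25 : ℝ)) = 10 * Real.exp 4 * D * (Λ ^ 2 * ℓ ^ (-(9 / 25 : ℝ))) := by rw [hK']; ring
          _ ≤ 10 * Real.exp 4 * D * (12 * τ) := mul_le_mul_of_nonneg_left h2 (by positivity)
          _ = 120 * Real.exp 4 * D * τ := by ring
      have hSz : ‖SZ‖ / z ≤ (120 * Real.exp 4 * D + 4 * |C₁|) * τ := by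
        calc ‖SZ‖ / z ≤ _ := hT1
          _ ≤ 120 * Real.exp 4 * D * τ + 4 * |C₁| * τ := add_le_add hmainz hrem_z
          _ = (120 * Real.exp 4 * D + 4 * |C₁|) * τ := by ring
      exact hfinish hSx hSz (by positivity) (by positivity) (by rw [hK]; linarith)
  · /- Case (ii): `|y₀| < √ℓ` -/
    have hy₀s : |y₀| ≤ Real.sqrt (Real.log x) := by rw [← hℓ]; exact hii.le
    have hlogey : Real.log (Real.exp 1 + |y₀|) ≤ Λ := by
      rw [hΛ]
      refine Real.log_le_log (by positivity) ?_
      have h1 : Real.exp 1 ≤ 3 := by have := Real.exp_one_lt_d9; linarith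
      -- `3 + √ℓ ≤ ℓ` since `√ℓ ≥ 8`
      nlinarith only [h1, hii, hsqrtℓ, hsqrtℓ8]
    -- `L⋆ ≤ 1` for the two Theorem 1 applications of case (ii-a)
    have hsmall : 2 * Real.exp 11 * ℓ ^ (-a) ≤ 1 := by
      have h1 : ℓ ^ (-a) ≤ ℓ ^ (-(267 / 1000 : ℝ)) := Real.rpow_le_rpow_of_exponent_le hℓ1 (by linarith)
      have h2 : ℓ ^ (-(267 / 1000 : ℝ)) ≤ (Real.exp 64) ^ (-(267 / 1000 : ℝ)) :=
        Real.rpow_le_rpow_of_nonpos (Real.exp_pos _) hℓe64 (by norm_num)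
      rw [← Real.exp_mul] at h2
      have h3 : 2 * Real.exp 11 * Real.exp (64 * -(267 / 1000 : ℝ)) ≤ 1 := by
        have h4 : (2 : ℝ) ≤ Real.exp 1 := by have := Real.add_one_le_exp (1:ℝ); linarith
        calc 2 * Real.exp 11 * Real.exp (64 * -(267 / 1000 : ℝ))
            ≤ Real.exp 1 * Real.exp 11 * Real.exp (64 * -(267 / 1000 : ℝ)) := by gcongr
          _ = Real.exp (1 + 11 + 64 * -(267 / 1000 : ℝ)) := by rw [Real.exp_add, Real.exp_add]
          _ ≤ Real.exp 0 := Real.exp_le_exp.2 (by norm_num)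
          _ = 1 := Real.exp_zero
      have h5 : 0 ≤ Real.exp 11 := (Real.exp_pos _).le
      nlinarith only [h1, h2, h3, h5]
    have hsmall' : Real.exp 7 * ℓ ^ (-a) ≤ 1 := by
      have : Real.exp 7 ≤ 2 * Real.exp 11 := by
        have h1 : Real.exp 7 ≤ Real.exp 11 := Real.exp_le_exp.2 (by norm_num)
        linarith [Real.exp_pos 11]
      nlinarith only [this, hsmall, Real.rpow_nonneg hℓ0.le (-a)]
    set M₀ := Msum f x y₀ with hM₀
    rcases le_or_gt (a * Λ) M₀ with hiia | hiib
    · /- (ii-a): large distance — (4.5) upper bound and Theorem 1 at both scales -/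
      have hΛF : ΛF ≤ Real.exp 7 * ℓ * ℓ ^ (-a) := by
        have h1 := norm_truncEulerProduct_le (g := f) hfb hf11 (x := x) (by linarith) y₀
        rw [← hℓ, ← hM₀] at h1
        have h2 : Real.exp (-M₀) ≤ ℓ ^ (-a) := by
          rw [Real.rpow_def_of_pos hℓ0, ← hΛ]
          exact Real.exp_le_exp.2 (by nlinarith only [hiia])
        calc ΛF ≤ Real.exp 7 * ℓ * Real.exp (-M₀) := h1
          _ ≤ Real.exp 7 * ℓ * ℓ ^ (-a) := mul_le_mul_of_nonneg_left h2 (by positivity)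
      -- at `x`
      have hLs_x : maxModulus f x (Real.log x) / Real.log x ≤ Real.exp 7 * ℓ ^ (-a) := by
        refine hLx.trans ?_
        rw [div_le_iff₀ hℓ0]
        calc ΛF ≤ Real.exp 7 * ℓ * ℓ ^ (-a) := hΛF
          _ = Real.exp 7 * ℓ ^ (-a) * ℓ := by ring
      have hT1x := thm1_apply H1 hf hfb hx3 (by rw [← hℓ]; exact hℓ1) hLs_x hsmall' (by positivity)
      have hmain_x : Real.exp 7 * ℓ ^ (-a) * (4 + Real.log (1 / (Real.exp 7 * ℓ ^ (-a)))) ≤ 5 * Real.exp 7 * τ := by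
        have h1 := Ls_main_le (K' := Real.exp 7) (c := a) (by have := Real.add_one_le_exp (7:ℝ); linarith)
          (by linarith) hℓ1 (by rw [← hΛ]; linarith)
        rw [← hΛ] at h1
        calc _ ≤ 5 * Real.exp 7 * Λ * ℓ ^ (-a) := h1
          _ = 5 * Real.exp 7 * τ := by rw [hτ]; ring
      have hSx : ‖SX‖ / x ≤ (5 * Real.exp 7 + 2 * |C₁|) * τ := by
        calc ‖SX‖ / x ≤ _ := hT1x
          _ ≤ 5 * Real.exp 7 * τ + 2 * |C₁| * τ := add_le_add hmain_x hrem_x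
          _ = (5 * Real.exp 7 + 2 * |C₁|) * τ := by ring
      -- at `x/w`
      have hLs_z : maxModulus f z (Real.log z) / Real.log z ≤ 2 * Real.exp 11 * ℓ ^ (-a) := by
        refine (hLz (hF1le.trans hΛF)).trans (le_of_eq ?_)
        rw [show (11 : ℝ) = 4 + 7 by norm_num, Real.exp_add]
        field_simp
      have hT1z := thm1_apply H1 hf hfb hz3 (by rw [← hℓ']; exact hℓ'1) hLs_z hsmall (by positivity)
      have hmain_z : 2 * Real.exp 11 * ℓ ^ (-a) * (4 + Real.log (1 / (2 * Real.exp 11 * ℓ ^ (-a)))) ≤ 10 * Real.exp 11 * τ := by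
        have h1 := Ls_main_le (K' := 2 * Real.exp 11) (c := a) (by have := Real.add_one_le_exp (11:ℝ); linarith)
          (by linarith) hℓ1 (by rw [← hΛ]; linarith)
        rw [← hΛ] at h1
        calc _ ≤ 5 * (2 * Real.exp 11) * Λ * ℓ ^ (-a) := h1
          _ = 10 * Real.exp 11 * τ := by rw [hτ]; ring
      have hSz : ‖SZ‖ / z ≤ (10 * Real.exp 11 + 4 * |C₁|) * τ := by
        calc ‖SZ‖ / z ≤ _ := hT1z
          _ ≤ 10 * Real.exp 11 * τ + 4 * |C₁| * τ := add_le_add hmain_z hrem_z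
          _ = (10 * Real.exp 11 + 4 * |C₁|) * τ := by ring
      exact hfinish hSx hSz (by positivity) (by positivity) (by rw [hK]; linarith)
    · /- (ii-b): small distance — Lemma 7.1 (twist by `y₀`) at both scales and Theorem 4 -/
      set g₀ := twistAF f y₀ with hg₀
      have hg₀m : g₀.IsMultiplicative := isMultiplicative_twistAF hf y₀
      have hg₀1 : ∀ n, ‖g₀ n‖ ≤ 1 := norm_twistAF_le hfb y₀
      -- (7.4): `∑_{p ≤ x} |1 - g₀(p)|/p ≤ (√3 - 1)(Λ + 2)`
      have hMert : ∑ p ∈ Nat.primesBelow (⌊x⌋₊ + 1), (1 : ℝ) / p ≤ Λ + 4 := by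
        have hN : 2 ≤ ⌊x⌋₊ := Nat.le_floor (by norm_num; linarith)
        refine (Literature.NumberTheory.LFunctions.MertensBound.sum_inv_prime_le ⌊x⌋₊ hN).trans ?_
        have hfl : (⌊x⌋₊ : ℝ) ≤ x := Nat.floor_le hxpos.le
        have hfl2 : (2 : ℝ) ≤ ⌊x⌋₊ := by exact_mod_cast hN
        have := Real.log_le_log (Real.log_pos (by linarith)) (Real.log_le_log (by linarith) hfl)
        rw [← hℓ, ← hΛ] at this; linarith
      have hs3 : Real.sqrt 3 * Real.sqrt 3 = 3 := Real.mul_self_sqrt (by norm_num)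
      have hs31 : 0 ≤ Real.sqrt 3 - 1 := by linarith
      have hSg : ∑ p ∈ Nat.primesBelow (⌊x⌋₊ + 1), ‖1 - g₀ p‖ / p ≤ (Real.sqrt 3 - 1) * (Λ + 2) := by
        have hcs := sq_sum_norm_one_sub_le hfb x y₀
        rw [← hM₀] at hcs
        set Sg1 := ∑ p ∈ Nat.primesBelow (⌊x⌋₊ + 1), ‖1 - f p * (p : ℂ) ^ (-(y₀ * I))‖ / p with hSg1
        have hSgeq : ∑ p ∈ Nat.primesBelow (⌊x⌋₊ + 1), ‖1 - g₀ p‖ / p = Sg1 := by rw [hSg1]; rfl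
        rw [hSgeq]
        have hSg0 : 0 ≤ Sg1 := Finset.sum_nonneg fun p _ => by positivity
        have hM₀0 : 0 ≤ M₀ := by
          rw [hM₀, Msum]
          refine Finset.sum_nonneg fun p hp => div_nonneg ?_ (Nat.cast_nonneg _)
          have h := norm_natCast_cpow_mul_I p (-y₀)
          rw [show ((-y₀ : ℝ) : ℂ) * I = -(y₀ * I) by push_cast; ring] at h
          have : (f p * (p : ℂ) ^ (-(y₀ * I))).re ≤ ‖f p * (p : ℂ) ^ (-(y₀ * I))‖ := Complex.re_le_norm _
          have : ‖f p * (p : ℂ) ^ (-(y₀ * I))‖ ≤ 1 := by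
            rw [norm_mul]; exact mul_le_one₀ (hfb p) (norm_nonneg _) h
          linarith
        have hT0 : 0 ≤ (Real.sqrt 3 - 1) * (Λ + 2) := by positivity
        have hsq : Sg1 * Sg1 ≤ ((Real.sqrt 3 - 1) * (Λ + 2)) * ((Real.sqrt 3 - 1) * (Λ + 2)) := by
          have e : ((Real.sqrt 3 - 1) * (Λ + 2)) * ((Real.sqrt 3 - 1) * (Λ + 2)) = 2 * a * (Λ + 2) ^ 2 := by
            rw [ha]; linear_combination (Λ + 2) ^ 2 * hs3
          rw [e]
          have ha0 : 0 ≤ a := by linarith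
          calc Sg1 * Sg1 = Sg1 ^ 2 := (sq Sg1).symm
            _ ≤ 2 * (∑ p ∈ Nat.primesBelow (⌊x⌋₊ + 1), (1 : ℝ) / p) * M₀ := hcs
            _ ≤ 2 * (Λ + 4) * (a * Λ) :=
                mul_le_mul (mul_le_mul_of_nonneg_left hMert zero_le_two) hiib.le hM₀0 (by positivity)
            _ = 2 * a * (Λ ^ 2 + 4 * Λ) := by ring
            _ ≤ 2 * a * (Λ + 2) ^ 2 := mul_le_mul_of_nonneg_left (by nlinarith only [hΛ0]) (by positivity)
        exact (mul_self_le_mul_self_iff hSg0 hT0).2 hsq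
      -- `exp(∑_{p ≤ Z} |1 - g₀(p)|/p) ≤ e^{3/2} ℓ^{√3-1}` for `Z ≤ x`
      have hexpS : Real.exp (∑ p ∈ Nat.primesBelow (⌊x⌋₊ + 1), ‖1 - g₀ p‖ / p)
          ≤ Real.exp (3 / 2) * ℓ ^ (Real.sqrt 3 - 1) := by
        have h1 : (Real.sqrt 3 - 1) * (Λ + 2) ≤ 3 / 2 + (Real.sqrt 3 - 1) * Λ := by
          have : 2 * (Real.sqrt 3 - 1) ≤ 3 / 2 := by linarith
          linarith
        calc Real.exp (∑ p ∈ Nat.primesBelow (⌊x⌋₊ + 1), ‖1 - g₀ p‖ / p)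
            ≤ Real.exp ((Real.sqrt 3 - 1) * (Λ + 2)) := Real.exp_le_exp.2 hSg
          _ ≤ Real.exp (3 / 2 + (Real.sqrt 3 - 1) * Λ) := Real.exp_le_exp.2 h1
          _ = Real.exp (3 / 2) * ℓ ^ (Real.sqrt 3 - 1) := by
              rw [Real.rpow_def_of_pos hℓ0, ← hΛ, ← Real.exp_add]; congr 1; ring
      have hexpZ : ∀ {Z : ℝ}, Z ≤ x → Real.exp (∑ p ∈ Nat.primesBelow (⌊Z⌋₊ + 1), ‖1 - g₀ p‖ / p)
          ≤ Real.exp (3 / 2) * ℓ ^ (Real.sqrt 3 - 1) := by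
        intro Z hZx
        refine le_trans (Real.exp_le_exp.2 ?_) hexpS
        exact Finset.sum_le_sum_of_subset_of_nonneg (primesBelow_mono hZx) fun p _ _ => by positivity
      have hpow_a : ℓ ^ (Real.sqrt 3 - 1) * ℓ⁻¹ = ℓ ^ (-a) := by
        rw [← Real.rpow_neg_one, ← Real.rpow_add hℓ0, ha]; congr 1; ring
      -- Lemma 7.1 at `Z ∈ {x, x/w}` for the twist `g₀`
      have hu1 : 1 ≤ ‖1 + (y₀ : ℂ) * I‖ := one_le_norm_one_add_mul_I y₀
      have hu0 : 0 < ‖1 + (y₀ : ℂ) * I‖ := by linarith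
      have hL71 : ∀ {Z : ℝ}, 3 ≤ Z → Z ≤ x → 1 / Real.log Z ≤ 2 * ℓ⁻¹ →
          |‖∑ n ∈ Icc 1 ⌊Z⌋₊, f n‖ - ‖∑ n ∈ Icc 1 ⌊Z⌋₊, g₀ n‖ / ‖1 + (y₀ : ℂ) * I‖|
            ≤ 2 * Real.exp (3 / 2) * |C₇| * τ * Z := by
        intro Z hZ3 hZx hlogZ
        have hZ0 : 0 < Z := by linarith
        have key := H7 g₀ hg₀m hg₀1 Z hZ3 y₀
        rw [hg₀, sum_twistAF_mul_cpow f y₀, ← hg₀] at key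
        have hnorm : ‖(Z : ℂ) ^ ((y₀ : ℂ) * I) / (1 + (y₀ : ℂ) * I) * ∑ n ∈ Icc 1 ⌊Z⌋₊, g₀ n‖
            = ‖∑ n ∈ Icc 1 ⌊Z⌋₊, g₀ n‖ / ‖1 + (y₀ : ℂ) * I‖ := by
          rw [norm_mul, norm_div, norm_ofReal_cpow_mul_I hZ0 y₀]; ring
        have herr : C₇ * (Z / Real.log Z) * Real.log (Real.exp 1 + |y₀|)
            * Real.exp (∑ p ∈ Nat.primesBelow (⌊Z⌋₊ + 1), ‖1 - g₀ p‖ / p)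
              ≤ 2 * Real.exp (3 / 2) * |C₇| * τ * Z := by
          have hlZ0 : 0 < Real.log Z := Real.log_pos (by linarith)
          have hq0 : 0 ≤ Z / Real.log Z := div_nonneg hZ0.le hlZ0.le
          have hl0 : 0 ≤ Real.log (Real.exp 1 + |y₀|) :=
            Real.log_nonneg (by linarith [Real.add_one_le_exp (1:ℝ), abs_nonneg y₀])
          have hZl : Z / Real.log Z ≤ 2 * Z * ℓ⁻¹ := by
            have e : Z / Real.log Z = Z * (1 / Real.log Z) := by ring
            rw [e]
            calc Z * (1 / Real.log Z) ≤ Z * (2 * ℓ⁻¹) := mul_le_mul_of_nonneg_left hlogZ hZ0.le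
              _ = 2 * Z * ℓ⁻¹ := by ring
          have a1 : C₇ * (Z / Real.log Z) * Real.log (Real.exp 1 + |y₀|) ≤ |C₇| * (2 * Z * ℓ⁻¹) * Λ :=
            calc C₇ * (Z / Real.log Z) * Real.log (Real.exp 1 + |y₀|)
                ≤ |C₇| * (Z / Real.log Z) * Real.log (Real.exp 1 + |y₀|) :=
                  mul_le_mul_of_nonneg_right (mul_le_mul_of_nonneg_right (le_abs_self C₇) hq0) hl0
              _ ≤ |C₇| * (2 * Z * ℓ⁻¹) * Λ :=
                  mul_le_mul (mul_le_mul_of_nonneg_left hZl (abs_nonneg _)) hlogey hl0 (by positivity)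
          calc C₇ * (Z / Real.log Z) * Real.log (Real.exp 1 + |y₀|)
                * Real.exp (∑ p ∈ Nat.primesBelow (⌊Z⌋₊ + 1), ‖1 - g₀ p‖ / p)
              ≤ |C₇| * (2 * Z * ℓ⁻¹) * Λ * (Real.exp (3 / 2) * ℓ ^ (Real.sqrt 3 - 1)) :=
                mul_le_mul a1 (hexpZ hZx) (Real.exp_pos _).le (by positivity)
            _ = 2 * Real.exp (3 / 2) * |C₇| * (Λ * (ℓ ^ (Real.sqrt 3 - 1) * ℓ⁻¹)) * Z := by ring
            _ = 2 * Real.exp (3 / 2) * |C₇| * τ * Z := by rw [hpow_a, ← hτ]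
        have h1 := abs_norm_sub_norm_le (∑ n ∈ Icc 1 ⌊Z⌋₊, f n)
          ((Z : ℂ) ^ ((y₀ : ℂ) * I) / (1 + (y₀ : ℂ) * I) * ∑ n ∈ Icc 1 ⌊Z⌋₊, g₀ n)
        rw [hnorm] at h1
        exact h1.trans (key.trans herr)
      have hAx := hL71 hx3 le_rfl (by rw [← hℓ, one_div]; linarith [inv_nonneg.2 hℓ0.le])
      have hAz := hL71 hz3 hzx (by rw [← hℓ']; exact hinvℓ')
      -- Theorem 4 for the twisted means
      have key4 := H4 f hf hfb x hx₄ y₀ hy₀s hmax' w hw1 hw2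
      have e1 : ∀ N : ℕ, ∑ n ∈ Icc 1 N, f n * (n : ℂ) ^ (-((y₀ : ℂ) * I)) = ∑ n ∈ Icc 1 N, g₀ n := fun N => rfl
      rw [e1, e1, ← hz, ← hWt] at key4
      obtain ⟨TX, hTX⟩ : ∃ T : ℂ, T = ∑ n ∈ Icc 1 ⌊x⌋₊, g₀ n := ⟨_, rfl⟩
      obtain ⟨TZ, hTZ⟩ : ∃ T : ℂ, T = ∑ n ∈ Icc 1 ⌊z⌋₊, g₀ n := ⟨_, rfl⟩
      rw [← hTX, ← hTZ] at key4
      rw [← hTX] at hAx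
      rw [← hTZ] at hAz
      have hPX : ‖(x : ℂ)⁻¹ * TX‖ = ‖TX‖ / x := by
        rw [norm_mul, norm_inv, Complex.norm_real, Real.norm_eq_abs, abs_of_pos hxpos]; ring
      have hPZ : ‖(((w / x : ℝ)) : ℂ) * TZ‖ = w / x * ‖TZ‖ := by
        rw [norm_mul, Complex.norm_real, Real.norm_eq_abs, abs_of_pos (by positivity)]
      have hmid : |‖TX‖ / x - w / x * ‖TZ‖| ≤ |C₄| * Wt + 24 * |C₄| * τ := by
        have h2 := abs_norm_sub_norm_le ((x : ℂ)⁻¹ * TX) ((((w / x : ℝ)) : ℂ) * TZ)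
        rw [hPX, hPZ] at h2
        refine h2.trans (key4.trans ?_)
        have hR0 : 0 ≤ Real.log (Real.log x) ^ (1 + 2 * (1 - 2 / Real.pi)) / Real.log x ^ (1 - 2 / Real.pi) := by
          rw [← hℓ]; positivity
        calc C₄ * (Wt + Real.log (Real.log x) ^ (1 + 2 * (1 - 2 / Real.pi)) / Real.log x ^ (1 - 2 / Real.pi))
            ≤ |C₄| * (Wt + Real.log (Real.log x) ^ (1 + 2 * (1 - 2 / Real.pi)) / Real.log x ^ (1 - 2 / Real.pi)) :=
              mul_le_mul_of_nonneg_right (le_abs_self _) (by positivity)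
          _ ≤ |C₄| * (Wt + 24 * τ) := mul_le_mul_of_nonneg_left (by linarith) hc4
          _ = |C₄| * Wt + 24 * |C₄| * τ := by ring
      -- divide and combine
      have hAx' : |‖SX‖ / x - ‖TX‖ / ‖1 + (y₀ : ℂ) * I‖ / x| ≤ 2 * Real.exp (3 / 2) * |C₇| * τ := by
        have e : ‖SX‖ / x - ‖TX‖ / ‖1 + (y₀ : ℂ) * I‖ / x = (‖SX‖ - ‖TX‖ / ‖1 + (y₀ : ℂ) * I‖) / x := by ring
        rw [e, abs_div, abs_of_pos hxpos, div_le_iff₀ hxpos]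
        exact hAx
      have hAz' : |w / x * ‖SZ‖ - w / x * (‖TZ‖ / ‖1 + (y₀ : ℂ) * I‖)| ≤ 2 * Real.exp (3 / 2) * |C₇| * τ := by
        have e : w / x * ‖SZ‖ - w / x * (‖TZ‖ / ‖1 + (y₀ : ℂ) * I‖) = (w / x) * (‖SZ‖ - ‖TZ‖ / ‖1 + (y₀ : ℂ) * I‖) := by ring
        rw [e, abs_mul, abs_of_pos (by positivity : (0:ℝ) < w / x)]
        calc w / x * |‖SZ‖ - ‖TZ‖ / ‖1 + (y₀ : ℂ) * I‖|
            ≤ w / x * (2 * Real.exp (3 / 2) * |C₇| * τ * z) := mul_le_mul_of_nonneg_left hAz (by positivity)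
          _ = 2 * Real.exp (3 / 2) * |C₇| * τ := by rw [hz]; field_simp
      have hmid' : |‖TX‖ / ‖1 + (y₀ : ℂ) * I‖ / x - w / x * (‖TZ‖ / ‖1 + (y₀ : ℂ) * I‖)| ≤ |C₄| * Wt + 24 * |C₄| * τ := by
        have e : ‖TX‖ / ‖1 + (y₀ : ℂ) * I‖ / x - w / x * (‖TZ‖ / ‖1 + (y₀ : ℂ) * I‖)
            = (‖TX‖ / x - w / x * ‖TZ‖) / ‖1 + (y₀ : ℂ) * I‖ := by ring
        rw [e, abs_div, abs_of_pos hu0]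
        exact (div_le_self (abs_nonneg _) hu1).trans hmid
      have htot : |‖SX‖ / x - w / x * ‖SZ‖| ≤ |C₄| * Wt + (24 * |C₄| + 4 * Real.exp (3 / 2) * |C₇|) * τ := by
        have e : ‖SX‖ / x - w / x * ‖SZ‖
            = (‖SX‖ / x - ‖TX‖ / ‖1 + (y₀ : ℂ) * I‖ / x)
              + (‖TX‖ / ‖1 + (y₀ : ℂ) * I‖ / x - w / x * (‖TZ‖ / ‖1 + (y₀ : ℂ) * I‖))
              - (w / x * ‖SZ‖ - w / x * (‖TZ‖ / ‖1 + (y₀ : ℂ) * I‖)) := by ring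
        rw [e]
        refine (abs_sub _ _).trans ?_
        refine (add_le_add (abs_add_le _ _) le_rfl).trans ?_
        linarith [hAx', hAz', hmid']
      have hKτ : (24 * |C₄| + 4 * Real.exp (3 / 2) * |C₇|) * τ ≤ K * τ :=
        mul_le_mul_of_nonneg_right (by rw [hK]; linarith) hτ0.le
      calc |‖SX‖ / x - w / x * ‖SZ‖| ≤ |C₄| * Wt + (24 * |C₄| + 4 * Real.exp (3 / 2) * |C₇|) * τ := htot
        _ ≤ |C₄| * Wt + K * τ := by linarith
        _ ≤ (|C₄| + K) * (Wt + τ) := by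
            have h1 : 0 ≤ |C₄| * τ := by positivity
            have h2 : 0 ≤ K * Wt := mul_nonneg hK0 hWt0
            nlinarith only [h1, h2]


end Literature.NumberTheory.LFunctions.GranvilleSoundararajan
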